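import Summits.MatrixMultiplication.OmegaCensus.TwoGenBox

/-!
# ω-census, family (b3): conjecture C9 (b) — the two-generator box theorem (part 2: intervals, separation, assembly)

HONEST FRAMING (pub-omega census; verbatim): lottery ticket; floor = certified bounds/negative ranges.
Census BOOKKEEPING (conjecture C9 of the cell, STRUCTURE.md §2, `BoxRatioSectionLaw`; pub-omega stpp-1 gen 23, the atom lane).
Nothing here is progress on `ω`.

With the box `Y = {1, a^x, a^{2x}}`, `W = {1, a^{3x}, b}` of `TwoGenBox` and `λ : R → 𝔽_p` additive, `λ x = t`, `λ (u x) = 0`, the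
pattern `{(c, r) : λ r ∈ A_c}` is independent as soon as the nine residue sets `A_c ⊆ 𝔽_p` avoid the `72` differences
`hcoef c c' · t`.  The sets are INTERVALS of representatives:
* `p = 6L + 5`, `t = L + 1` (`= 6⁻¹`): `A_(0,0) = [1, L]`, the other five `b⁰`-columns `[0, L]`, `A_(0,2) = [3L+3, 6L+4]`,
  `A_(1,2) = [2L+2, 3L+2]`, `A_(2,2) = [L+1, 2L+1]`; total `11L + 9`, and `5(11L + 9) − 9p = L ≥ 0` (`sep5`, `sum_card_A5`);
* `p = 6L + 1`, `t = −L` (`= 6⁻¹`): the six `b⁰`-columns `[0, L−1]`, `A_(0,2) = [L, 3L−1]`, `A_(1,2) = [3L, 5L−1]`,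
  `A_(2,2) = [5L, 6L]`; total `11L + 1`, and `5(11L + 1) − 9p = L − 4 ≥ 0` iff `L ≥ 4` (`sep1`, `sum_card_A1`).
The separation proofs are `81`-fold case splits closed by `omega` on the representatives (`val_cases_of_sub_eq`).
**`TwoGen.not_boxUseful`**: for every prime `p ≥ 5` other than `7, 13, 19`, every `q ≥ 1`, every finite commutative ring `R`,
`u ∈ R` with `u ^ q = 1`, and `x ∈ R` admitting an additive `λ₀ : R → 𝔽_p` with `λ₀ (u x) = 0 ≠ λ₀ x` (i.e. `x, u x` linearly
independent over `𝔽_p`): `¬ BoxUseful (R ⋊_u ℤ/q)`.  For `p ∈ {7, 13, 19}` the two-generator family provably cannot reach `9/5`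
(supremum `11/6`, see part 1); those primes and `p = 2, 3` are treated with three generators elsewhere.  Consumers transport
along injections / surjections with `not_boxUseful_of_injective'` / `not_boxUseful_of_surjective'` (`BoxUsefulDihedral`).
-/

namespace Summit.MatrixMultiplication.OmegaCensus

open Finset ProductBoxBound

/-! ### The nine intervals: sizes and separation (pure arithmetic in `ZMod p`, any `p`) -/

namespace TwoGen

variable {p : ℕ} [NeZero p]

/-! #### `p = 6L + 5` -/

/-- Lower ends of the nine intervals, `p = 6L + 5`. [folklore] -/
def lo5 (L : ℕ) (c : Fin 3 × Fin 3) : ℕ :=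
  if c.2.val = 2 then (if c.1.val = 0 then 3 * L + 3 else if c.1.val = 1 then 2 * L + 2 else L + 1)
  else if c.1.val = 0 ∧ c.2.val = 0 then 1 else 0

/-- Upper ends of the nine intervals, `p = 6L + 5`. [folklore] -/
def hi5 (L : ℕ) (c : Fin 3 × Fin 3) : ℕ :=
  if c.2.val = 2 then (if c.1.val = 0 then 6 * L + 4 else if c.1.val = 1 then 3 * L + 2 else 2 * L + 1) else L

variable (p) in
/-- The column sets for `p = 6L + 5`. [folklore] -/
def A5 (L : ℕ) (c : Fin 3 × Fin 3) : Finset (ZMod p) := Ival p (lo5 L c) (hi5 L c)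

/-- Total size `11L + 9` for `p = 6L + 5`. [folklore] -/
theorem sum_card_A5 (L : ℕ) (hp : p = 6 * L + 5) : ∑ c, #(A5 p L c) = 11 * L + 9 := by
  rw [Fintype.sum_prod_type]
  simp (disch := omega) [Fin.sum_univ_three, A5, lo5, hi5, card_Ival]
  omega

/-- **Separation, `p = 6L + 5`.** The nine intervals avoid all `72` differences `hcoef c c' · (L + 1)`. [folklore] -/
theorem sep5 (L : ℕ) (hp : p = 6 * L + 5) (c c' : Fin 3 × Fin 3) (hcc : c ≠ c') :
    ∀ z ∈ A5 p L c, ∀ z' ∈ A5 p L c', z - z' ≠ ((hcoef c c' * (L + 1) : ℤ) : ZMod p) := by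
  intro z hz z' hz' h
  rw [A5, mem_Ival] at hz hz'
  obtain ⟨hb1, hb2⟩ := hcoef_bound c c'
  have hb3 : hcoef c c' * ((L : ℤ) + 1) ≤ 5 * ((L : ℤ) + 1) := mul_le_mul_of_nonneg_right hb2 (by positivity)
  have hb4 : -5 * ((L : ℤ) + 1) ≤ hcoef c c' * ((L : ℤ) + 1) := mul_le_mul_of_nonneg_right hb1 (by positivity)
  have key := val_cases_of_sub_eq h (by rw [hp]; push_cast; linarith) (by rw [hp]; push_cast; linarith)
  have hzp := z.val_lt
  have hzp' := z'.val_lt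
  clear h hb3 hb4
  obtain ⟨i, j⟩ := c
  obtain ⟨i', j'⟩ := c'
  fin_cases i <;> fin_cases j <;> fin_cases i' <;> fin_cases j' <;>
    simp (decide := true) only [hcoef, M, N, B, lo5, hi5, if_true, if_false, Nat.cast_ofNat, Nat.cast_zero, Nat.cast_one,
      Int.reduceAdd, Int.reduceSub, Int.reduceNeg, zero_mul, mul_zero, add_zero, zero_add, mul_one, one_mul]
      at key hz hz' hcc <;> omega

/-! #### `p = 6L + 1` -/

/-- Lower ends of the nine intervals, `p = 6L + 1`. [folklore] -/
def lo1 (L : ℕ) (c : Fin 3 × Fin 3) : ℕ :=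
  if c.2.val = 2 then (if c.1.val = 0 then L else if c.1.val = 1 then 3 * L else 5 * L) else 0

/-- Upper ends of the nine intervals, `p = 6L + 1` (`L ≥ 1`). [folklore] -/
def hi1 (L : ℕ) (c : Fin 3 × Fin 3) : ℕ :=
  if c.2.val = 2 then (if c.1.val = 0 then 3 * L - 1 else if c.1.val = 1 then 5 * L - 1 else 6 * L) else L - 1

variable (p) in
/-- The column sets for `p = 6L + 1`. [folklore] -/
def A1 (L : ℕ) (c : Fin 3 × Fin 3) : Finset (ZMod p) := Ival p (lo1 L c) (hi1 L c)

/-- Total size `11L + 1` for `p = 6L + 1`, `L ≥ 1`. [folklore] -/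
theorem sum_card_A1 (L : ℕ) (hL : 1 ≤ L) (hp : p = 6 * L + 1) : ∑ c, #(A1 p L c) = 11 * L + 1 := by
  rw [Fintype.sum_prod_type]
  simp (disch := omega) [Fin.sum_univ_three, A1, lo1, hi1, card_Ival]
  omega

/-- **Separation, `p = 6L + 1`, `L ≥ 1`.** The nine intervals avoid all `72` differences `hcoef c c' · (−L)` (`−L = 6⁻¹`).
[folklore] -/
theorem sep1 (L : ℕ) (hL : 1 ≤ L) (hp : p = 6 * L + 1) (c c' : Fin 3 × Fin 3) (hcc : c ≠ c') :
    ∀ z ∈ A1 p L c, ∀ z' ∈ A1 p L c', z - z' ≠ ((hcoef c c' * (-(L : ℤ)) : ℤ) : ZMod p) := by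
  intro z hz z' hz' h
  rw [A1, mem_Ival] at hz hz'
  obtain ⟨hb1, hb2⟩ := hcoef_bound c c'
  have hb3 : 5 * (-(L : ℤ)) ≤ hcoef c c' * (-(L : ℤ)) := mul_le_mul_of_nonpos_right hb2 (by simp)
  have hb4 : hcoef c c' * (-(L : ℤ)) ≤ -5 * (-(L : ℤ)) := mul_le_mul_of_nonpos_right hb1 (by simp)
  have key := val_cases_of_sub_eq h (by rw [hp]; push_cast; linarith) (by rw [hp]; push_cast; linarith)
  have hzp := z.val_lt
  have hzp' := z'.val_lt
  clear h hb3 hb4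
  obtain ⟨i, j⟩ := c
  obtain ⟨i', j'⟩ := c'
  fin_cases i <;> fin_cases j <;> fin_cases i' <;> fin_cases j' <;>
    simp (decide := true) only [hcoef, M, N, B, lo1, hi1, if_true, if_false, Nat.cast_ofNat, Nat.cast_zero, Nat.cast_one,
      Int.reduceAdd, Int.reduceSub, Int.reduceNeg, zero_mul, mul_zero, add_zero, zero_add, mul_one, one_mul, mul_neg,
      neg_mul, neg_neg] at key hz hz' hcc <;> omega

end TwoGen

/-! ### The functional `λ` and the main theorems -/

namespace TwoGen

section Functional

variable {R : Type*} [CommRing R] {u x : R} {p : ℕ} [Fact p.Prime]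

/-- From `λ₀ (u x) = 0 ≠ λ₀ x`: for every `T` an additive `λ` with `λ x = T`, `λ (u x) = 0`. [folklore] -/
theorem exists_lam (lam₀ : R →+ ZMod p) (hux : lam₀ (u * x) = 0) (hx : lam₀ x ≠ 0) (T : ZMod p) :
    ∃ lam : R →+ ZMod p, lam x = T ∧ lam (u * x) = 0 :=
  ⟨(AddMonoidHom.mulLeft (T * (lam₀ x)⁻¹)).comp lam₀,
    by rw [AddMonoidHom.comp_apply, AddMonoidHom.coe_mulLeft, mul_assoc, inv_mul_cancel₀ hx, mul_one],
    by rw [AddMonoidHom.comp_apply, AddMonoidHom.coe_mulLeft, hux, mul_zero]⟩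

/-- With `λ x = T ≠ 0`: `m x = m' x` for `m, m' ∈ [0, 3]` forces `m = m'` (as `p ≥ 5`). [folklore] -/
theorem coef_inj (hp5 : 5 ≤ p) (lam : R →+ ZMod p) {T : ZMod p} (hT : lam x = T) (hT0 : T ≠ 0) :
    ∀ m m' : ℤ, 0 ≤ m → m ≤ 3 → 0 ≤ m' → m' ≤ 3 → (m : R) * x = (m' : R) * x → m = m' := by
  intro m m' h1 h2 h3 h4 h
  have h' := congrArg lam h
  rw [← zsmul_eq_mul, ← zsmul_eq_mul, map_zsmul, map_zsmul, hT, zsmul_eq_mul, zsmul_eq_mul] at h'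
  have h'' : ((m - m' : ℤ) : ZMod p) = 0 := by rw [Int.cast_sub, mul_right_cancel₀ hT0 h', sub_self]
  have hd := (ZMod.intCast_zmod_eq_zero_iff_dvd _ p).1 h''
  have : m - m' = 0 := Int.eq_zero_of_abs_lt_dvd hd (by rw [abs_lt]; constructor <;> omega)
  omega

/-- `λ` with `λ x = T ≠ 0` is surjective onto `ZMod p`. [folklore] -/
theorem lam_surjective (lam : R →+ ZMod p) {T : ZMod p} (hT : lam x = T) (hT0 : T ≠ 0) : Function.Surjective lam := by
  intro z
  refine ⟨(((z * T⁻¹).val : ℕ) : R) * x, ?_⟩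
  rw [← nsmul_eq_mul, map_nsmul, hT, nsmul_eq_mul, ZMod.natCast_zmod_val, mul_assoc, inv_mul_cancel₀ hT0, mul_one]

end Functional

section Main

variable {R : Type*} [CommRing R] [Fintype R] [DecidableEq R] {q : ℕ} [NeZero q] {u : R} [Fact (u ^ q = 1)]
variable {p : ℕ} [Fact p.Prime]

omit [Fintype R] [DecidableEq R] in
/-- `q ≥ 2` is automatic: for `q = 1`, `u = 1` and `λ₀ (u x) = 0 ≠ λ₀ x` is absurd. [folklore] -/
theorem one_lt_q {P : Type*} [AddZeroClass P] {x : R} (lam₀ : R →+ P) (hux : lam₀ (u * x) = 0) (hx : lam₀ x ≠ 0) :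
    Fact (1 < q) := by
  refine ⟨lt_of_not_ge fun hq => hx ?_⟩
  have hq1 : q = 1 := le_antisymm hq (Nat.pos_of_ne_zero (NeZero.ne q))
  have hu : u = 1 := by have := (Fact.out : u ^ q = 1); rwa [hq1, pow_one] at this
  rwa [hu, one_mul] at hux

/-- **`p ≡ 5 (mod 6)`.** For `p = 6L + 5` prime, `R ⋊_u ℤ/q` is not box-useful as soon as some additive `λ₀ : R → 𝔽_p` has
`λ₀ (u x) = 0 ≠ λ₀ x`. [folklore] -/
theorem not_boxUseful_mod_five (L : ℕ) (hp : p = 6 * L + 5) (x : R) (lam₀ : R →+ ZMod p) (hux : lam₀ (u * x) = 0)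
    (hx : lam₀ x ≠ 0) : ¬ BoxUseful (RCyc R q u) := by
  haveI := one_lt_q (q := q) lam₀ hux hx
  set T : ZMod p := ((L + 1 : ℕ) : ZMod p) with hTdef
  have hT0 : T ≠ 0 := by
    rw [hTdef, Ne, ZMod.natCast_eq_zero_iff]
    exact fun h => absurd (Nat.le_of_dvd (by omega) h) (by omega)
  obtain ⟨lam, hT, hux'⟩ := exists_lam lam₀ hux hx T
  have hD := box_nondeg (q := q) (u := u) (coef_inj (by omega) lam hT hT0)
  refine (box q x).not_boxUseful_of_lamPattern hD lam (lam_surjective lam hT hT0) (A5 p L)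
    (fun c c' => ((hcoef c c' * (L + 1) : ℤ) : ZMod p)) (fun c c' _ => ?_) (sep5 L hp) ?_
  · rw [lam_dd lam hux', hT, hTdef, zsmul_eq_mul]; push_cast; ring
  · rw [ZMod.card, sum_card_A5 L hp]; omega

/-- **`p ≡ 1 (mod 6)`, `p ≥ 25`.** For `p = 6L + 1` prime with `L ≥ 4`, `R ⋊_u ℤ/q` is not box-useful as soon as some additive
`λ₀ : R → 𝔽_p` has `λ₀ (u x) = 0 ≠ λ₀ x`. [folklore] -/
theorem not_boxUseful_mod_one (L : ℕ) (hL : 4 ≤ L) (hp : p = 6 * L + 1) (x : R) (lam₀ : R →+ ZMod p)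
    (hux : lam₀ (u * x) = 0) (hx : lam₀ x ≠ 0) : ¬ BoxUseful (RCyc R q u) := by
  haveI := one_lt_q (q := q) lam₀ hux hx
  set T : ZMod p := ((-(L : ℤ) : ℤ) : ZMod p) with hTdef
  have hT0 : T ≠ 0 := by
    rw [hTdef, Ne, ZMod.intCast_zmod_eq_zero_iff_dvd]
    intro h
    have := Int.le_of_dvd (by omega) (Int.dvd_neg.1 h)
    omega
  obtain ⟨lam, hT, hux'⟩ := exists_lam lam₀ hux hx T
  have hD := box_nondeg (q := q) (u := u) (coef_inj (by omega) lam hT hT0)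
  refine (box q x).not_boxUseful_of_lamPattern hD lam (lam_surjective lam hT hT0) (A1 p L)
    (fun c c' => ((hcoef c c' * (-(L : ℤ)) : ℤ) : ZMod p)) (fun c c' _ => ?_) (sep1 L (by omega) hp) ?_
  · rw [lam_dd lam hux', hT, hTdef, zsmul_eq_mul]; push_cast; ring
  · rw [ZMod.card, sum_card_A1 L (by omega) hp]; omega

/-- **The two-generator box theorem.**  Let `p ≥ 5` be a prime other than `7, 13, 19`; `R` a finite commutative ring, `u ∈ R`
with `u ^ q = 1` (`q ≥ 1`), and `x ∈ R` such that some additive `λ₀ : R → 𝔽_p` has `λ₀ (u·x) = 0 ≠ λ₀ x` (i.e. `x, u x` are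
`𝔽_p`-linearly independent).  Then `R ⋊_u ℤ/q` is not box-useful: `α(G;|G|,3,3) ≥ (9/5)|G|`.  In particular the Schmidt atoms
`𝔽_{p^k} ⋊ μ_q` with `k ≥ 2` for these `p`, for every prime `q`. [folklore] -/
theorem not_boxUseful (hp5 : 5 ≤ p) (h7 : p ≠ 7) (h13 : p ≠ 13) (h19 : p ≠ 19) (x : R) (lam₀ : R →+ ZMod p)
    (hux : lam₀ (u * x) = 0) (hx : lam₀ x ≠ 0) : ¬ BoxUseful (RCyc R q u) := by
  have hp' : p.Prime := Fact.out
  have h2 : ¬ 2 ∣ p := fun h => by have := (Nat.prime_dvd_prime_iff_eq Nat.prime_two hp').1 h; omega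
  have h3 : ¬ 3 ∣ p := fun h => by have := (Nat.prime_dvd_prime_iff_eq Nat.prime_three hp').1 h; omega
  have hmod : p % 6 = 1 ∨ p % 6 = 5 := by omega
  rcases hmod with h1 | h5
  · exact not_boxUseful_mod_one (p / 6) (by omega) (by omega) x lam₀ hux hx
  · exact not_boxUseful_mod_five (p / 6) (by omega) x lam₀ hux hx

end Main

end TwoGen

end Summit.MatrixMultiplication.OmegaCensus
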